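import Literature.Computability.Learning.EvalFP
import HarnessLib

/-!
# IW98 Lemma 15, the circuits: the CIKK hypothesis evaluator driven by an INDEXED test

Literature / complexity — derandomization under a uniform assumption (Case 2 of the printed proof
of `impagliazzoWigderson1998` = van Melkebeek Thm. 6.2.1 = IW98 Thm. 5). Impagliazzo–Wigderson's
Lemma 15 (`D^{G_f,1/5} →^{fₙ} C^f`, §2.4: Lemmas 18–20 — NW predictor with oracle tables,
Goldreich–Levin, uniform direct-product decoding — "All stages are identical to those from the
non-uniform proofs") is, mathematically, the reconstruction that Carmosino–Impagliazzo–Kabanets–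
Kolokolova run as a LEARNER (CCC 2016, §5), and the tree holds that reconstruction completely:
the counting theorem `Learning.card_goodRun_ge` (`NaturalLearningRun.lean`) is stated for an
ARBITRARY test `D : (Fin L → Bool) → Bool` of advantage `≥ 1/5` against the NW generator of
`AMP(f) = (f^k)^{GL}`, and the hypothesis evaluator `Learning.evalFn dR = decodeFn (candVecFn (predFn dR))`
(`EvalFP.lean`) is parametric in its innermost stage. Only that innermost stage — the predictor
`predFn dR`, which applies the decision procedure `dR` of a natural PROPERTY to the hybrid string —
is specific to natural proofs. In IW98 the test is instead an INDEX `z = ⟨x, [b]⟩` of the one-sided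
test `T_{x,b} = {r | [⟨x, r⟩ ∈ L''] = b}` of a fixed `L'' ∈ P` (`IWUniform.test`, `IWUniform.goodIdx`,
`UniformDerandomizationDistinguishers/TestSampler.lean`), sampled at run time (Lemma 13), so the
evaluator must read the test off the DESCRIPTION. This file makes that one change, storing the
index in the free first field `pad` of the predictor header `predHdr pad q ℓ n' L`:

* `IWRecon.idxTest L'' pad ℓ` — the test `y ↦ [⟨fstF pad, ofFn y⟩ ∈ L'' ↔ (sndF pad).headD = 1]`
  on `Fin (2^ℓ) → Bool` named by the index `pad = ⟨x, [b]⟩` (membership in `IWUniform.test`);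
* `IWRecon.testFn dL` — its string form on `⟨pad, y⟩` for a decider `dL` of `L''`
  (`testFn_apply`, `testFn_mem_FP`);
* `IWRecon.predFnIdx dL` — the table-based NW predictor of `NWPredictorFP.lean` with the test read
  off `pad` (`predFnIdx_mem_FP`, `predFnIdx_apply_str`) and **`predFnIdx_eq_nwPredictor`**: on a
  genuine record it computes `nwPredictor (learnerDesign …) g (idxTest L'' pad ℓ) i z w x`
  (the proof of `Learning.predFn_eq_nwPredictor` with the property test replaced);
* `IWRecon.evalFnIdx dL = decodeFn (candVecFn (predFnIdx dL))` — the evaluator of the descriptions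
  `hypRec pad …` (`evalFnIdx_mem_FP`, `oneBit_evalFnIdx`) and **`evalFnIdx_apply`**: it computes
  the run's hypothesis `runHyp (learnerDesign …) (idxTest L'' pad ℓ) f ω` — so that
  `Learning.card_goodRun_ge` applies verbatim to the descriptions read by `evalFnIdx dL`;
* `IWRecon.setPadFn` — writing the index into the `pad` slot of a description built with `pad = ε`
  (as the learner's table machinery builds them, `LearnerTablesFP.lean`): `setPadFn ⟨pad, hypRec ε …⟩
  = hypRec pad …` (`setPadFn_hypRec`, `setPadFn_mem_FP`).

Everything is proved; no named facts. (Next files: the construction as a truth-table transducer and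
the weak-to-strong selection, `UniformDerandomizationTransducers.lean`.)

## References

* [ImpagliazzoWigderson2001] R. Impagliazzo, A. Wigderson, JCSS 63 (2001) 672–688, Def. 3,
  Lemma 15 and §2.4 (Lemmas 18–20; held text pp. 6–8).
* [CarmosinoImpagliazzoKabanetsKolokolova2016] M. Carmosino, R. Impagliazzo, V. Kabanets,
  A. Kolokolova, *Learning algorithms from natural proofs*, CCC 2016, §2.4 (reconstruction, circuit
  construction steps 1–3), §5 (complete algorithm), Thm. 2.11.
* [NisanWigderson1994] N. Nisan, A. Wigderson, JCSS 49 (1994), Lemma 2.4 (the predictor).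
-/

noncomputable section

namespace Literature.Computability.Complexity

namespace IWRecon

open _root_.Computability Polynomial Brick Plumb Literature.Computability.Learning
  Literature.Computability.MetaComplexity Literature.Computability.Cryptography
  Literature.Computability.Complexity.DirectProduct

/-! ### The indexed test -/

/-- **The test named by an index** `pad = ⟨x, [b]⟩` (IW Def. 3 in the tree's one-sided form
`IWUniform.test L'' x b = {r | ⟨x, r⟩ ∈ L'' ↔ b = 1}`), as a Boolean function on `2^ℓ`-bit strings.
[cite: ImpagliazzoWigderson2001, Def. 3] -/
def idxTest (L'' : Language Bool) (pad : List Bool) (ℓ : ℕ) (y : Fin (2 ^ ℓ) → Bool) : Bool :=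
  decide (L''.boolIndicator (boolPair (fstF pad) (List.ofFn y)) = (sndF pad).headD false)

/-- The indexed test accepts `y` iff `⟨x, y⟩ ∈ L'' ↔ b = 1` (membership in `IWUniform.test L'' x b`
for `pad = ⟨x, s⟩`, `b = s.headD`). [cite: ImpagliazzoWigderson2001, Def. 3] -/
theorem idxTest_eq_true_iff (L'' : Language Bool) (pad : List Bool) (ℓ : ℕ) (y : Fin (2 ^ ℓ) → Bool) :
    idxTest L'' pad ℓ y = true ↔ (boolPair (fstF pad) (List.ofFn y) ∈ L'' ↔ (sndF pad).headD false = true) := by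
  rw [idxTest, decide_eq_true_eq]
  by_cases hm : boolPair (fstF pad) (List.ofFn y) ∈ L''
  · rw [(Set.mem_iff_boolIndicator _ _).1 hm]
    constructor
    · intro h; exact ⟨fun _ => h.symm, fun _ => hm⟩
    · intro h; exact (h.1 hm).symm
  · rw [(Set.notMem_iff_boolIndicator _ _).1 hm]
    constructor
    · intro h; exact ⟨fun h' => absurd h' hm, fun h' => by rw [← h] at h'; exact absurd h' Bool.false_ne_true⟩
    · intro h
      cases hs : (sndF pad).headD false
      · rfl
      · exact absurd (h.2 hs) hm

variable (dL : List Bool → List Bool)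

/-- **The test as a string function** on `⟨pad, y⟩`: compare the verdict bit of the decider `dL` of
`L''` on `⟨fstF pad, y⟩` with the sign bit `(sndF pad).headD`. [cite: ImpagliazzoWigderson2001, Def. 3] -/
def testFn : List Bool → List Bool :=
  eqPairFn ∘ fanoutFn (HashBricks.headBitFn ∘ dL ∘ fanoutFn (fstF ∘ fstF) sndF)
    (HashBricks.headBitFn ∘ sndF ∘ fstF)

/-- `testFn dL ∈ FP` for `dL ∈ FP`. [folklore] -/
theorem testFn_mem_FP (hdL : dL ∈ FP) : testFn dL ∈ FP :=
  comp_mem_FP eqPairFn_mem_FP (fanoutFn_mem_FP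
    (comp_mem_FP HashBricks.headBitFn_mem_FP (comp_mem_FP hdL (fanoutFn_mem_FP (comp_mem_FP fstF_mem_FP fstF_mem_FP) sndF_mem_FP)))
    (comp_mem_FP HashBricks.headBitFn_mem_FP (comp_mem_FP sndF_mem_FP fstF_mem_FP)))

/-- Value of `testFn` (string level). [folklore] -/
theorem testFn_apply_str (pad y : List Bool) :
    testFn dL (boolPair pad y) =
      [decide ((dL (boolPair (fstF pad) y)).headD false = (sndF pad).headD false)] := by
  simp only [testFn, Function.comp_apply, fanoutFn_apply, fstF_boolPair, sndF_boolPair,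
    HashBricks.headBitFn_apply, eqPairFn_boolPair]
  congr 1
  by_cases h : (dL (boolPair (fstF pad) y)).headD false = (sndF pad).headD false
  · rw [h]; simp
  · simp only [List.cons.injEq, and_true, h, decide_false]

/-- **Value of `testFn`** for a decider of `L''` in indicator format: the indexed test.
[cite: ImpagliazzoWigderson2001, Def. 3] -/
theorem testFn_apply {L'' : Language Bool} (hdL : ∀ u, dL u = encodeBool (L''.boolIndicator u))
    (pad : List Bool) {ℓ : ℕ} (y : Fin (2 ^ ℓ) → Bool) :
    testFn dL (boolPair pad (List.ofFn y)) = [idxTest L'' pad ℓ y] := by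
  rw [testFn_apply_str, hdL, idxTest]
  have henc : ∀ b : Bool, (encodeBool b).headD false = b := fun b => by cases b <;> rfl
  rw [henc]

/-! ### The indexed predictor -/

/-- **The table-based NW predictor with the test read off the description**: answer `¬ w_i` if the
indexed test accepts the hybrid string, `w_i` otherwise (`Learning.predFn` with `dR ∘ hybFn`
replaced by `testFn dL ∘ ⟨pad, hybFn⟩`, `pad = fstF (fstF (fstF Π))` on `Π = ⟨P, x⟩`).
[cite: CarmosinoImpagliazzoKabanetsKolokolova2016, §2.4 (circuit construction, step 3)] [cite: NisanWigderson1994, Lemma 2.4] -/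
def predFnIdx : List Bool → List Bool :=
  iteFn (HashBricks.headBitFn ∘ testFn dL ∘ fanoutFn (fstF ∘ fstF ∘ fstF) hybFn) wiFn (notFn wiFn)

/-- `predFnIdx dL ∈ FP` for `dL ∈ FP`. [cite: AroraBarakCC2009, §1.3] -/
theorem predFnIdx_mem_FP (hdL : dL ∈ FP) : predFnIdx dL ∈ FP :=
  iteFn_mem_FP (comp_mem_FP HashBricks.headBitFn_mem_FP (comp_mem_FP (testFn_mem_FP dL hdL)
      (fanoutFn_mem_FP (comp_mem_FP fstF_mem_FP (comp_mem_FP fstF_mem_FP fstF_mem_FP)) hybFn_mem_FP)))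
    wiFn_mem_FP (notFn_mem_FP wiFn_mem_FP)

/-- `predFnIdx dL` is one-bit on every input. [folklore] -/
theorem oneBit_predFnIdx : OneBit (predFnIdx dL) :=
  ((HashBricks.oneBit_headBitFn).comp _).ite oneBit_wiFn (oneBit_notFn oneBit_wiFn)

/-- **Value of `predFnIdx`** (string level): `w_i` if the indexed test accepts the hybrid string,
`¬ w_i` otherwise (the test here ACCEPTS pseudorandom-looking strings, whereas CIKK's property test
rejects them — hence the branches of `Learning.predFn` are exchanged). [folklore] -/
theorem predFnIdx_apply_str (pad : List Bool) (q ℓ n' L : ℕ) (ibits wbits tables zbits xbits : List Bool)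
    (hi : bitsToNat ibits < L) :
    predFnIdx dL (boolPair (predRec (predHdr pad q ℓ n' L) ibits wbits tables zbits) xbits) =
      [if (testFn dL (boolPair pad
          (hybFn (boolPair (predRec (predHdr pad q ℓ n' L) ibits wbits tables zbits) xbits)))).headD false
        then (wbits.drop (bitsToNat ibits)).headD false else !((wbits.drop (bitsToNat ibits)).headD false)] := by
  have hpad : (fstF ∘ fstF ∘ fstF) (boolPair (predRec (predHdr pad q ℓ n' L) ibits wbits tables zbits) xbits) = pad := by
    simp [predRec, predHdr]
  rw [predFnIdx, iteFn_apply (b := (testFn dL (boolPair pad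
      (hybFn (boolPair (predRec (predHdr pad q ℓ n' L) ibits wbits tables zbits) xbits)))).headD false)
    (by rw [Function.comp_apply, Function.comp_apply, fanoutFn_apply, hpad, HashBricks.headBitFn_apply])]
  split_ifs with h
  · rw [wiFn_apply pad q ℓ n' L ibits wbits tables zbits xbits hi]
  · rw [notFn_apply (wiFn_apply pad q ℓ n' L ibits wbits tables zbits xbits hi)]

open MCSPVerif in
/-- **The indexed machine predictor is the NW predictor with the indexed test.** On the record of
the challenge block `i`, the advice `w`, the list code of tables whose `j`-th item is the table of
block `j`, and the seed, with `dL` deciding `L''` in indicator format,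
`predFnIdx dL ⟨P, x⟩ = [nwPredictor (learnerDesign …) g (idxTest L'' pad ℓ) i z w x]`.
[cite: CarmosinoImpagliazzoKabanetsKolokolova2016, Thm. 2.11] [cite: ImpagliazzoWigderson2001, Lemma 18] -/
theorem predFnIdx_eq_nwPredictor {q n k ℓ : ℕ} [Fact q.Prime] (hn : k * n + k ≤ q) {L'' : Language Bool}
    (hdL : ∀ u, dL u = encodeBool (L''.boolIndicator u))
    (pad : List Bool) (g : (Fin (k * n + k) → Bool) → Bool) (i : Fin (2 ^ ℓ)) (z : Fin (q * q) → Bool)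
    (w : Fin (2 ^ ℓ) → Bool) (x : Fin (k * n + k) → Bool) (tbls : List (List Bool))
    (htbls : ∀ j : Fin (2 ^ ℓ), (j : ℕ) < i → tbls.getD j [] = tableList (learnerDesign q n k ℓ hn) g q i j z) :
    predFnIdx dL (boolPair (predRec (predHdr pad q ℓ (k * n + k) (2 ^ ℓ))
      (List.ofFn ((boolFunEquivFin ℓ).symm i)) (List.ofFn w) (OracleCompose.body tbls) (List.ofFn z))
      (List.ofFn x)) = [nwPredictor (learnerDesign q n k ℓ hn) g (idxTest L'' pad ℓ) i z w x] := by
  classical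
  have hival : bitsToNat (List.ofFn ((boolFunEquivFin ℓ).symm i)) = i := bitsToNat_ofFn_symm i
  have hi : bitsToNat (List.ofFn ((boolFunEquivFin ℓ).symm i)) < 2 ^ ℓ := by rw [hival]; exact i.isLt
  -- the hybrid string is `ofFn hyb`
  have hstr : hybFn (boolPair (predRec (predHdr pad q ℓ (k * n + k) (2 ^ ℓ)) (List.ofFn ((boolFunEquivFin ℓ).symm i))
      (List.ofFn w) (OracleCompose.body tbls) (List.ofFn z)) (List.ofFn x)) = List.ofFn (hybOfTables hn g i z w x) := by
    rw [hybFn_apply, ccat_congr (g' := fun j => [if h : j < 2 ^ ℓ then hybOfTables hn g i z w x ⟨j, h⟩ else false])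
      (fun j hj => by rw [hybPiece_eq hn pad g i z w x tbls htbls j hj, dif_pos hj]), ccat_singleton_eq_ofFn]
    exact congrArg List.ofFn (funext fun j => by rw [dif_pos j.isLt])
  rw [predFnIdx_apply_str dL pad q ℓ (k * n + k) (2 ^ ℓ) _ (List.ofFn w) (OracleCompose.body tbls) (List.ofFn z)
    (List.ofFn x) hi, hstr, testFn_apply dL hdL, hival, headD_drop_ofFn w i.isLt,
    nwPredictor_eq_predictOfTables hn (idxTest L'' pad ℓ) i z w x g]
  rw [show predictOfTables (idxTest L'' pad ℓ) i (fun j => tableList (learnerDesign q n k ℓ hn) g q i j z)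
      (fun j => idxOf q ℓ (k * n + k) i j x) w =
      (if idxTest L'' pad ℓ (hybOfTables hn g i z w x) = true then w i else !(w i)) from rfl]
  simp only [List.headD_cons, Fin.eta]

/-! ### The indexed evaluator -/

/-- **The evaluator of IW's circuits**: DP decoder ∘ GL stage ∘ indexed table-based NW predictor
(`Learning.evalFn` with `predFnIdx`). [cite: ImpagliazzoWigderson2001, §2.4 (Lemmas 18–20)]
[cite: CarmosinoImpagliazzoKabanetsKolokolova2016, §5 (steps 3–5)] -/
def evalFnIdx : List Bool → List Bool :=
  decodeFn (candVecFn (predFnIdx dL))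

/-- **`evalFnIdx dL ∈ FP`** for `dL ∈ FP`. [cite: CarmosinoImpagliazzoKabanetsKolokolova2016, Thm. 5.1 (running time)] -/
theorem evalFnIdx_mem_FP (hdL : dL ∈ FP) : evalFnIdx dL ∈ FP :=
  decodeFn_mem_FP (candVecFn_mem_FP (predFnIdx_mem_FP dL hdL))

/-- `evalFnIdx dL` is one-bit. [folklore] -/
theorem oneBit_evalFnIdx : OneBit (evalFnIdx dL) := oneBit_decodeFn _

/-- **The indexed evaluator computes the run's hypothesis.** If the stored tables are the tables of
`AMP(f)` for the challenge block `i` and seed `z`, then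
`evalFnIdx dL ⟨hypRec pad …, x⟩ = [runHyp (learnerDesign …) (idxTest L'' pad ℓ) f ω x]` — the
hypothesis whose coins are counted by `Learning.card_goodRun_ge`.
[cite: ImpagliazzoWigderson2001, Lemma 15] [cite: CarmosinoImpagliazzoKabanetsKolokolova2016, §5 and Thm. 5.1] -/
theorem evalFnIdx_apply {q n k ℓ kk t : ℕ} [Fact q.Prime] (hn : k * n + k ≤ q) {L'' : Language Bool}
    (hdL : ∀ u, dL u = encodeBool (L''.boolIndicator u))
    (pad : List Bool) (f : (Fin n → Bool) → Bool) (ω : RunCoins n k (2 ^ ℓ) (q * q) kk t) (tbls : List (List Bool))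
    (htbls : ∀ j : Fin (2 ^ ℓ), (j : ℕ) < ω.1.1 →
      tbls.getD j [] = tableList (learnerDesign q n k ℓ hn) (ampFnFin f k) q ω.1.1 j ω.1.2.1)
    (x : Fin n → Bool) :
    evalFnIdx dL (boolPair (hypRec pad q n k ℓ kk t tbls f ω) (List.ofFn x)) =
      [runHyp (learnerDesign q n k ℓ hn) (idxTest L'' pad ℓ) f ω x] := by
  rw [evalFnIdx, hypRec, runHyp,
    decodeFn_apply (glStage (nwStage (learnerDesign q n k ℓ hn) (idxTest L'' pad ℓ) f ω.1) ω.2.1)]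
  intro xs
  rw [show ω.2.1 = (ω.2.1.1, ω.2.1.2) from rfl]
  exact candVecFn_apply _ (fun u => predFnIdx_eq_nwPredictor dL hn hdL pad (ampFnFin f k) ω.1.1 ω.1.2.1 ω.1.2.2 u
    tbls htbls) ω.2.1.1 ω.2.1.2 xs

/-! ### Writing the index into a description -/

/-- **Set the `pad` slot**: `⟨pad, ⟨⟨⟨⟨pad₀, H⟩, P⟩, G⟩, D⟩⟩ ↦ ⟨⟨⟨⟨pad, H⟩, P⟩, G⟩, D⟩` — the four
record layers `dpRec (glRec (predRec (predHdr pad₀ …) …) …) …` are each `⟨inner, rest⟩`.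
[folklore] -/
def setPadFn : List Bool → List Bool :=
  fanoutFn
    (fanoutFn
      (fanoutFn
        (fanoutFn fstF (sndF ∘ fstF ∘ fstF ∘ fstF ∘ sndF))
        (sndF ∘ fstF ∘ fstF ∘ sndF))
      (sndF ∘ fstF ∘ sndF))
    (sndF ∘ sndF)

/-- `setPadFn ∈ FP`. [folklore] -/
theorem setPadFn_mem_FP : setPadFn ∈ FP :=
  fanoutFn_mem_FP
    (fanoutFn_mem_FP
      (fanoutFn_mem_FP
        (fanoutFn_mem_FP fstF_mem_FP (comp_mem_FP sndF_mem_FP (comp_mem_FP fstF_mem_FP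
          (comp_mem_FP fstF_mem_FP (comp_mem_FP fstF_mem_FP sndF_mem_FP)))))
        (comp_mem_FP sndF_mem_FP (comp_mem_FP fstF_mem_FP (comp_mem_FP fstF_mem_FP sndF_mem_FP))))
      (comp_mem_FP sndF_mem_FP (comp_mem_FP fstF_mem_FP sndF_mem_FP)))
    (comp_mem_FP sndF_mem_FP sndF_mem_FP)

/-- Value of `setPadFn` on four nested layers. [folklore] -/
theorem setPadFn_apply (pad pad₀ H P G D : List Bool) :
    setPadFn (boolPair pad (boolPair (boolPair (boolPair (boolPair pad₀ H) P) G) D)) =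
      boolPair (boolPair (boolPair (boolPair pad H) P) G) D := by
  simp [setPadFn]

/-- **`setPadFn` writes the index into a hypothesis record**: `setPadFn ⟨pad, hypRec pad₀ …⟩ = hypRec pad …`.
[folklore] -/
theorem setPadFn_hypRec (pad pad₀ : List Bool) (q n k ℓ kk t : ℕ) (tbls : List (List Bool))
    (f : (Fin n → Bool) → Bool) (ω : RunCoins n k (2 ^ ℓ) (q * q) kk t) :
    setPadFn (boolPair pad (hypRec pad₀ q n k ℓ kk t tbls f ω)) = hypRec pad q n k ℓ kk t tbls f ω := by
  simp only [hypRec, dpRec, glRec, predRec, predHdr]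
  exact setPadFn_apply _ _ _ _ _ _

end IWRecon

end Literature.Computability.Complexity

end
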